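import Mathlib.RingTheory.MvPolynomial.Basic
import Mathlib.Data.Finsupp.Multiset
import Mathlib.Data.Sym.Card
import Mathlib.LinearAlgebra.Dimension.StrongRankCondition
import Literature.Barriers.ValiantsHypothesis.PartialDerivativesDetPerm
import HarnessLib

/-!
# Full-rank flattenings of `(x₁² + ⋯ + xₙ²)ᵏ` (Reznick; Gesmundo–Landsberg, Thm. 4) — discharge of
the named fact `GesmundoLandsberg2017_thm4`

This file proves `GesmundoLandsberg2017_thm4_holds : GesmundoLandsberg2017_thm4`, the fact vendored
in `Literature/Barriers/ValiantsHypothesis/PartialDerivativesDetPerm.lean`: for `q = x₁² + ⋯ + xₙ²`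
(`n ≥ 1`) and `e ≤ k`, the `e`-th order partial derivatives of `qᵏ` span a space of dimension
`binom(n + e - 1, e) = dim Sᵉℂⁿ`, i.e. the flattening `(qᵏ)_{e,2k-e}` is injective (full rank).

**Source and architecture.** We follow the proof printed in Gesmundo–Landsberg, *Explicit polynomial
sequences with maximal spaces of partial derivatives and a question of K. Mulmuley*, Theory of
Computing 15 (2019), art. 3 (arXiv:1705.03866), §2 (the result is Reznick's, *Sums of even powers
of real linear forms*, Mem. AMS 463 (1992), Thm. 8.15; GL: "we include our proof ... because it
seems less involved and more accessible than the original one"):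

* Prop. 3 (p. 6 of the arXiv version): the first derivatives `∂ᵢ(h q)`, `h ∈ Sᵈ`, span `Sᵈ⁺¹`.
  Printed proof: for `|α| = d - 1`, `gᵢ := ∂ᵢ(q xᵢ xᵅ) = [2xᵢ² + (αᵢ+1) q] xᵅ`; the matrix
  `2·Id + 𝟙aᵀ` is invertible, so every non-square-free monomial is reached, and a square-free
  `xᵝ` with `β₁ = 1` is `½ ∂₁(q xᵝ/x₁)`. We prove it with the constant `2` replaced by an
  arbitrary positive integer `c` (`monomial_mem_of_gen_mem`): the generators are
  `c xᵢ xᵝ + q ∂ᵢxᵝ`, `|β| = d`; summing the `n` generators attached to `β = α + eᵢ` gives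
  `(c + |α| + n) q xᵅ`, whence `q xᵅ` and then each `xⱼ² xᵅ` (this is the printed rank-one
  inversion, done by hand), and `xᵝ = c⁻¹ (c xⱼ xᵝ⁻ᵉʲ⋅xⱼ)` when `βⱼ = 1`.
* Thm. 4 (ibid.): `(qᵏ)_{e,2k-e}(Sᵉ(ℂⁿ)*) = q^{k-e} Sᵉℂⁿ` for `e ≤ k`, by induction on `e` using
  `∂ᵢ(q^{k-e+1} xᵅ) = q^{k-e} (2(k-e+1) xᵢ xᵅ + q ∂ᵢxᵅ)` ("up to rescaling ... the term in
  parenthesis is `∂ᵢ(xᵅ q)`; these terms span `Sᵉ` by Proposition 3" — precisely the case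
  `c = 2(k-e+1)` of the generalised proposition). This is `span_derivSet_sumSq_pow`, stated with
  the tree's `derivSet` (the set of order-`e` iterated partials, `PartialDerivativesDetPerm.lean`)
  and Mathlib's `MvPolynomial.restrictSupport K {γ | γ.degree = e}` for `Sᵉ`.
* The rank: multiplication by `q^{k-e}` is injective (`q ≠ 0` as `n ≥ 1`), and
  `dim Sᵉ = #{γ : Fin n →₀ ℕ | |γ| = e} = #Sym(Fin n, e) = binom(n + e - 1, e)`
  (`Sym.card_sym_eq_choose`), giving `flatteningRank_sumSq_pow` over every field of
  characteristic `0` and the discharge over `ℂ`.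

Characteristic `0` is used exactly where the printed proof divides: by `c = 2(k-e+1)` and by
`c + |α| + n` (the determinant `cⁿ⁻¹(c + Σ(αᵢ+1))` of `c·Id + 𝟙aᵀ`). No new definitions are
introduced (`q` is written out as `∑ j, X j ^ 2`).

## References

* [GesmundoLandsberg2017] F. Gesmundo, J. M. Landsberg, Theory Comput. 15 (2019), art. 3,
  arXiv:1705.03866, §2: Prop. 3, Thm. 4, Rem. 5.
* [Reznick1992] B. Reznick, *Sums of even powers of real linear forms*, Mem. Amer. Math. Soc. 96
  (1992), no. 463 (the original source of Thm. 4, as cited by GL).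
* [LandsbergGCT2017] J. M. Landsberg, *Geometry and Complexity Theory*, CUP 2017, §6.2 (p. 161):
  the gloss "illustrating a weakness of the method of partial derivatives".
-/

open MvPolynomial Finset

noncomputable section

namespace Literature.Barriers.ValiantsHypothesis

/-! ### The set of order-`e` derivatives, recursively -/

section DerivSet

variable {R : Type*} [CommSemiring R] {σ : Type*}

/-- Order `0`: the only derivative of order `0` of `f` is `f`. [folklore] -/
theorem derivSet_zero (f : MvPolynomial σ R) : derivSet 0 f = {f} := by
  ext h
  simp only [derivSet, Set.mem_setOf_eq, Set.mem_singleton_iff, List.length_eq_zero_iff]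
  constructor
  · rintro ⟨l, rfl, rfl⟩
    rfl
  · rintro rfl
    exact ⟨[], rfl, rfl⟩

/-- Order `e + 1`: the first partial derivatives of the order-`e` derivatives. [folklore] -/
theorem derivSet_succ (e : ℕ) (f : MvPolynomial σ R) :
    derivSet (e + 1) f = ⋃ i, pderiv i '' derivSet e f := by
  ext h
  simp only [derivSet, Set.mem_setOf_eq, Set.mem_iUnion, Set.mem_image]
  constructor
  · rintro ⟨l, hl, rfl⟩
    cases l with
    | nil => simp at hl
    | cons i l =>
      exact ⟨i, iterPDeriv l f, ⟨l, by simpa using hl, rfl⟩, (iterPDeriv_cons i l f).symm⟩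
  · rintro ⟨i, g, ⟨l, hl, rfl⟩, rfl⟩
    exact ⟨i :: l, by simp [hl], (iterPDeriv_cons i l f).symm⟩

/-- The span of the order-`(e+1)` derivatives is the sum of the images of the span of the
order-`e` derivatives under the `∂ᵢ`. [folklore] -/
theorem span_derivSet_succ (e : ℕ) (f : MvPolynomial σ R) :
    Submodule.span R (derivSet (e + 1) f) =
      ⨆ i, (Submodule.span R (derivSet e f)).map
        ((pderiv i : Derivation R (MvPolynomial σ R) (MvPolynomial σ R)) :
          MvPolynomial σ R →ₗ[R] MvPolynomial σ R) := by
  rw [derivSet_succ, Submodule.span_iUnion]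
  refine iSup_congr fun i => ?_
  rw [Submodule.map_span]
  rfl

end DerivSet

/-! ### The quadric `q = x₁² + ⋯ + xₙ²` and its powers -/

section SumSq

variable {K : Type*} [Field K] {n : ℕ}

/-- `∂ᵢ q = 2xᵢ`. [cite: GesmundoLandsberg2017, proof of Prop. 3] -/
theorem pderiv_sumSq (i : Fin n) :
    pderiv i (∑ j : Fin n, (X j : MvPolynomial (Fin n) K) ^ 2) = 2 * X i := by
  rw [map_sum, Finset.sum_eq_single i]
  · rw [pderiv_pow, pderiv_X_self]
    norm_num
  · intro j _ hji
    rw [pderiv_pow, pderiv_X_of_ne hji, mul_zero]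
  · intro hi
    exact absurd (Finset.mem_univ i) hi

/-- `q ≠ 0` once there is a variable. [folklore] -/
theorem sumSq_ne_zero (hn : 1 ≤ n) : (∑ j : Fin n, (X j : MvPolynomial (Fin n) K) ^ 2) ≠ 0 := by
  intro h
  have h1 := congrArg (coeff (Finsupp.single (⟨0, hn⟩ : Fin n) 2)) h
  rw [coeff_sum, coeff_zero, Finset.sum_eq_single (⟨0, hn⟩ : Fin n)] at h1
  · rw [X_pow_eq_monomial, coeff_monomial, if_pos rfl] at h1
    exact one_ne_zero h1
  · intro j _ hj
    rw [X_pow_eq_monomial, coeff_monomial, if_neg]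
    exact fun hh => hj (Finsupp.single_left_injective (by norm_num) hh)
  · exact fun hh => absurd (Finset.mem_univ _) hh

/-- The Leibniz step of GL's induction: `∂ᵢ(q^{m+1} g) = qᵐ (2(m+1) xᵢ g + q ∂ᵢ g)`.
[cite: GesmundoLandsberg2017, proof of Thm. 4] -/
theorem pderiv_sumSq_pow_succ_mul (m : ℕ) (i : Fin n) (g : MvPolynomial (Fin n) K) :
    pderiv i ((∑ j : Fin n, (X j : MvPolynomial (Fin n) K) ^ 2) ^ (m + 1) * g) =
      (∑ j : Fin n, (X j : MvPolynomial (Fin n) K) ^ 2) ^ m *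
        (((2 * (m + 1) : ℕ) : K) • (X i * g) +
          (∑ j : Fin n, (X j : MvPolynomial (Fin n) K) ^ 2) * pderiv i g) := by
  rw [pderiv_mul, pderiv_pow, pderiv_sumSq, Nat.add_sub_cancel, smul_eq_C_mul, map_natCast]
  push_cast
  ring

/-- `xᵢ · xᵝ = x^{β + eᵢ}`. [folklore] -/
theorem X_mul_monomial_eq (i : Fin n) (β : Fin n →₀ ℕ) :
    (X i : MvPolynomial (Fin n) K) * monomial β 1 = monomial (β + Finsupp.single i 1) 1 := by
  rw [X, monomial_mul, one_mul, add_comm]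

/-- A monomial with coefficient `r` is `r` times the monic monomial. [folklore] -/
theorem monomial_eq_smul (s : Fin n →₀ ℕ) (r : K) :
    (monomial s r : MvPolynomial (Fin n) K) = r • monomial s 1 := by
  rw [smul_monomial, smul_eq_mul, mul_one]

/-- `q · xᵅ = Σᵢ x^{α + 2eᵢ}` — the diagonal form of `q` is what the proof uses (GL, Rem. 5).
[cite: GesmundoLandsberg2017, Rem. 5] -/
theorem sumSq_mul_monomial (α : Fin n →₀ ℕ) :
    (∑ j : Fin n, (X j : MvPolynomial (Fin n) K) ^ 2) * monomial α (1 : K) =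
      ∑ i : Fin n, monomial (α + Finsupp.single i 2) 1 := by
  rw [Finset.sum_mul]
  refine Finset.sum_congr rfl fun i _ => ?_
  rw [X_pow_eq_monomial, monomial_mul, one_mul, add_comm]

/-- Each generator `c xᵢ xᵝ + q ∂ᵢxᵝ` with `|β| = e` is a form of degree `e + 1` (the easy
inclusion `(ℂⁿ)* · (q Sᵉ) ⊆ Sᵉ⁺¹`). [cite: GesmundoLandsberg2017, Prop. 3] -/
theorem gen_mem_restrictSupport (c : K) (i : Fin n) {e : ℕ} {β : Fin n →₀ ℕ}
    (hβ : β.degree = e) :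
    c • ((X i : MvPolynomial (Fin n) K) * monomial β 1) +
        (∑ j : Fin n, (X j : MvPolynomial (Fin n) K) ^ 2) * pderiv i (monomial β 1) ∈
      restrictSupport K {γ : Fin n →₀ ℕ | γ.degree = e + 1} := by
  refine Submodule.add_mem _ (Submodule.smul_mem _ _ ?_) ?_
  · rw [X_mul_monomial_eq]
    exact (monomial_mem_restrictSupport (R := K)).2 (Or.inl (by simp [hβ]))
  · rw [pderiv_monomial, one_mul, Finset.sum_mul]
    refine Submodule.sum_mem _ fun j _ => ?_
    rw [X_pow_eq_monomial, monomial_mul, one_mul]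
    refine (monomial_mem_restrictSupport (R := K)).2 ?_
    by_cases hi : β i = 0
    · exact Or.inr (by simp [hi])
    · left
      show (Finsupp.single j 2 + (β - Finsupp.single i 1)).degree = e + 1
      have h1 : (β - Finsupp.single i 1).degree + 1 = e := by
        rw [← hβ]
        conv_rhs => rw [← Finsupp.sub_add_single_one_cancel hi]
        rw [map_add, Finsupp.degree_single]
      rw [map_add, Finsupp.degree_single]
      omega

/-- **Gesmundo–Landsberg, Prop. 3 (with a general positive constant).** If a subspace `N` contains
the generators `c xᵢ xᵝ + q ∂ᵢ xᵝ` for all `i` and all `|β| = e` (`c` a positive integer; `c = 2`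
is the printed `∂ᵢ(q xᵝ)`), then `N` contains every monomial of degree `e + 1`. Printed mechanism:
the `n` generators attached to `β = α + eᵢ` are `[c xᵢ² + (αᵢ+1) q] xᵅ`, and `c·Id + 𝟙aᵀ` is
invertible (its determinant is `cⁿ⁻¹ (c + Σᵢ(αᵢ+1)) ≠ 0` in characteristic `0`), which yields the
non-square-free monomials; a monomial with some exponent `βⱼ = 1` is `c⁻¹` times the generator
attached to `(j, β - eⱼ)`. [cite: GesmundoLandsberg2017, Prop. 3] -/
theorem monomial_mem_of_gen_mem [CharZero K] (N : Submodule K (MvPolynomial (Fin n) K)) {c : ℕ}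
    (hc : 0 < c) {e : ℕ}
    (hN : ∀ (i : Fin n) (β : Fin n →₀ ℕ), β.degree = e →
      (c : K) • ((X i : MvPolynomial (Fin n) K) * monomial β 1) +
        (∑ j : Fin n, (X j : MvPolynomial (Fin n) K) ^ 2) * pderiv i (monomial β 1) ∈ N)
    {γ : Fin n →₀ ℕ} (hγ : γ.degree = e + 1) :
    (monomial γ (1 : K) : MvPolynomial (Fin n) K) ∈ N := by
  have hc' : (c : K) ≠ 0 := Nat.cast_ne_zero.2 hc.ne'
  obtain ⟨j, hj⟩ : ∃ j, γ j ≠ 0 := by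
    by_contra h
    push Not at h
    have h0 : γ = 0 := Finsupp.ext h
    rw [h0, map_zero] at hγ
    exact Nat.succ_ne_zero e hγ.symm
  by_cases hj1 : γ j = 1
  · -- a monomial with `γⱼ = 1`: `c x^γ` is the generator attached to `(j, γ - eⱼ)`
    set β := γ - Finsupp.single j 1 with hβdef
    have hβγ : β + Finsupp.single j 1 = γ := Finsupp.sub_add_single_one_cancel hj
    have hβj : β j = 0 := by simp [hβdef, hj1]
    have hβ : β.degree = e := by
      have h2 := congrArg Finsupp.degree hβγ
      rw [map_add, Finsupp.degree_single, hγ] at h2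
      omega
    have h := hN j β hβ
    rw [pderiv_monomial, hβj, Nat.cast_zero, mul_zero, monomial_zero, mul_zero, add_zero,
      X_mul_monomial_eq, hβγ] at h
    exact (N.smul_mem_iff hc').1 h
  · -- `γⱼ ≥ 2`: write `γ = α + 2eⱼ` and invert the rank-one perturbation by hand
    have hj2 : 2 ≤ γ j := by omega
    set α := γ - Finsupp.single j 2 with hαdef
    have hαγ : α + Finsupp.single j 2 = γ :=
      tsub_add_cancel_of_le (Finsupp.single_le_iff.2 hj2)
    have hα : α.degree + 2 = e + 1 := by
      have h2 := congrArg Finsupp.degree hαγ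
      rwa [map_add, Finsupp.degree_single, hγ] at h2
    -- the generators attached to `β = α + eᵢ`
    have hg : ∀ i : Fin n, (c : K) • (monomial (α + Finsupp.single i 2) (1 : K) :
        MvPolynomial (Fin n) K) +
          ((α i + 1 : ℕ) : K) •
            ((∑ j : Fin n, (X j : MvPolynomial (Fin n) K) ^ 2) * monomial α 1) ∈ N := by
      intro i
      have h := hN i (α + Finsupp.single i 1) (by rw [map_add, Finsupp.degree_single]; omega)
      rwa [X_mul_monomial_eq, add_assoc, ← Finsupp.single_add, one_add_one_eq_two, pderiv_monomial,
        add_tsub_cancel_right, one_mul, Finsupp.add_apply, Finsupp.single_eq_same,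
        monomial_eq_smul α, mul_smul_comm] at h
    -- their sum is `(c + |α| + n) q xᵅ`
    have hsum : ((c + (α.degree + n) : ℕ) : K) •
        ((∑ j : Fin n, (X j : MvPolynomial (Fin n) K) ^ 2) * monomial α (1 : K)) =
        ∑ i : Fin n, ((c : K) • (monomial (α + Finsupp.single i 2) (1 : K) :
          MvPolynomial (Fin n) K) +
            ((α i + 1 : ℕ) : K) •
              ((∑ j : Fin n, (X j : MvPolynomial (Fin n) K) ^ 2) * monomial α 1)) := by
      rw [Finset.sum_add_distrib, ← Finset.smul_sum, ← Finset.sum_smul, ← sumSq_mul_monomial,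
        ← add_smul]
      congr 1
      rw [Finsupp.degree_eq_sum]
      push_cast
      rw [Finset.sum_add_distrib]
      simp
    have hqα : (∑ j : Fin n, (X j : MvPolynomial (Fin n) K) ^ 2) * monomial α (1 : K) ∈ N := by
      have hs : ((c + (α.degree + n) : ℕ) : K) ≠ 0 := Nat.cast_ne_zero.2 (by omega)
      rw [← N.smul_mem_iff hs, hsum]
      exact Submodule.sum_mem _ fun i _ => hg i
    -- `c x^γ = g_j - (αⱼ + 1) q xᵅ`
    have h := Submodule.sub_mem _ (hg j) (Submodule.smul_mem _ (((α j + 1 : ℕ) : K)) hqα)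
    rw [add_sub_cancel_right, hαγ] at h
    exact (N.smul_mem_iff hc').1 h

/-- **Gesmundo–Landsberg, Thm. 4 (Reznick): the space of `e`-th partial derivatives of `qᵏ` is
`q^{k-e} · Sᵉ`** for `e ≤ k` — "`(f_{n,k})_{e,2k-e}(Sᵉ(ℂⁿ)*) = qₙ^{k-e} Sᵉℂⁿ`". Here over any
field of characteristic `0`, with `Sᵉ = restrictSupport K {γ | |γ| = e}` (the forms of degree
`e`) and the tree's `derivSet`. [cite: GesmundoLandsberg2017, Thm. 4] -/
theorem span_derivSet_sumSq_pow [CharZero K] (k : ℕ) :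
    ∀ e : ℕ, e ≤ k →
      Submodule.span K (derivSet e ((∑ j : Fin n, (X j : MvPolynomial (Fin n) K) ^ 2) ^ k)) =
      (restrictSupport K {γ : Fin n →₀ ℕ | γ.degree = e}).map
        (LinearMap.mulLeft K ((∑ j : Fin n, (X j : MvPolynomial (Fin n) K) ^ 2) ^ (k - e))) := by
  intro e
  induction e with
  | zero =>
    intro _
    have h0 : {γ : Fin n →₀ ℕ | γ.degree = 0} = {0} := by
      ext γ
      simp only [Set.mem_setOf_eq, Set.mem_singleton_iff, Finsupp.degree_eq_zero_iff]
    rw [derivSet_zero, Nat.sub_zero, h0, restrictSupport_eq_span, Set.image_singleton,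
      Submodule.map_span, Set.image_singleton, LinearMap.mulLeft_apply, ← C_apply, C_1, mul_one]
  | succ e ih =>
    intro he
    obtain ⟨m, hm⟩ : ∃ m, k - e = m + 1 := ⟨k - (e + 1), by omega⟩
    have hm' : k - (e + 1) = m := by omega
    rw [span_derivSet_succ, ih (by omega), hm, hm']
    -- the Leibniz step as an identity of linear maps
    have key : ∀ i : Fin n,
        ((pderiv i : Derivation K (MvPolynomial (Fin n) K) (MvPolynomial (Fin n) K)) :
            MvPolynomial (Fin n) K →ₗ[K] MvPolynomial (Fin n) K) ∘ₗ
          LinearMap.mulLeft K ((∑ j : Fin n, (X j : MvPolynomial (Fin n) K) ^ 2) ^ (m + 1)) =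
        LinearMap.mulLeft K ((∑ j : Fin n, (X j : MvPolynomial (Fin n) K) ^ 2) ^ m) ∘ₗ
          ((((2 * (m + 1) : ℕ)) : K) • LinearMap.mulLeft K (X i : MvPolynomial (Fin n) K) +
            LinearMap.mulLeft K (∑ j : Fin n, (X j : MvPolynomial (Fin n) K) ^ 2) ∘ₗ
              ((pderiv i : Derivation K (MvPolynomial (Fin n) K) (MvPolynomial (Fin n) K)) :
                MvPolynomial (Fin n) K →ₗ[K] MvPolynomial (Fin n) K)) := by
      intro i
      refine LinearMap.ext fun g => ?_
      simp only [LinearMap.comp_apply, LinearMap.mulLeft_apply, LinearMap.add_apply,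
        LinearMap.smul_apply, Derivation.coeFn_coe]
      exact pderiv_sumSq_pow_succ_mul m i g
    simp_rw [← Submodule.map_comp, key, Submodule.map_comp, ← Submodule.map_iSup]
    congr 1
    apply le_antisymm
    · -- each generator is a form of degree `e + 1`
      refine iSup_le fun i => Submodule.map_le_iff_le_comap.2 ?_
      rw [restrictSupport_eq_span (R := K) (s := {γ : Fin n →₀ ℕ | γ.degree = e}),
        Submodule.span_le]
      rintro _ ⟨β, hβ, rfl⟩
      simp only [SetLike.mem_coe, Submodule.mem_comap, LinearMap.add_apply, LinearMap.smul_apply,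
        LinearMap.comp_apply, LinearMap.mulLeft_apply, Derivation.coeFn_coe]
      exact gen_mem_restrictSupport _ i hβ
    · -- GL Prop. 3 with `c = 2(m+1) = 2(k-e)`: every monomial of degree `e + 1` is reached
      rw [restrictSupport_eq_span (R := K) (s := {γ : Fin n →₀ ℕ | γ.degree = e + 1}),
        Submodule.span_le]
      rintro _ ⟨γ, hγ, rfl⟩
      refine monomial_mem_of_gen_mem _ (c := 2 * (m + 1)) (by omega) (e := e)
        (fun i β hβ => ?_) hγ
      refine Submodule.mem_iSup_of_mem i (Submodule.mem_map.2 ⟨monomial β 1,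
        (monomial_mem_restrictSupport (R := K)).2 (Or.inl hβ), ?_⟩)
      simp only [LinearMap.add_apply, LinearMap.smul_apply, LinearMap.comp_apply,
        LinearMap.mulLeft_apply, Derivation.coeFn_coe]

/-- There are `binom(n + e - 1, e)` monomials of degree `e` in `n` variables (multisets of size `e`
from `Fin n`: `Sym.equivNatSum`, `Sym.card_sym_eq_choose`). [folklore] -/
theorem card_monomials_degree (n e : ℕ) :
    Nat.card {γ : Fin n →₀ ℕ // γ.degree = e} = (n + e - 1).choose e := by
  let E : {γ : Fin n →₀ ℕ // γ.degree = e} ≃ Sym (Fin n) e :=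
    (Equiv.subtypeEquivRight fun γ => by rw [Finsupp.degree_apply]; exact Iff.rfl).trans
      (Sym.equivNatSum (Fin n) e).symm
  rw [Nat.card_congr E, Nat.card_eq_fintype_card, Sym.card_sym_eq_choose, Fintype.card_fin]

variable (K) in
/-- `dim_K Sᵉ(Kⁿ) = binom(n + e - 1, e)` (the monomials of degree `e` are a basis,
`MvPolynomial.basisRestrictSupport`). [folklore] -/
theorem finrank_restrictSupport_degree (n e : ℕ) :
    Module.finrank K (restrictSupport K {γ : Fin n →₀ ℕ | γ.degree = e}) =
      (n + e - 1).choose e := by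
  rw [Module.finrank_eq_nat_card_basis (basisRestrictSupport K _), ← card_monomials_degree n e]
  rfl

/-- **The flattenings of `qᵏ` have full rank** (GL Thm. 4, "In particular"): for `n ≥ 1` and
`e ≤ k`, `rank (qᵏ)_{e,2k-e} = dim Sᵉ = binom(n + e - 1, e)`, over every field of characteristic
`0`; the rank is the tree's `shiftedPartialsRank K e 0` (shift `0` = the method of partial
derivatives, `shiftedPartialsRank_zero_eq`). [cite: GesmundoLandsberg2017, Thm. 4] -/
theorem flatteningRank_sumSq_pow [CharZero K] (hn : 1 ≤ n) {k e : ℕ} (he : e ≤ k) :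
    shiftedPartialsRank K e 0 ((∑ j : Fin n, (X j : MvPolynomial (Fin n) K) ^ 2) ^ k) =
      (n + e - 1).choose e := by
  have hinj : Function.Injective
      (LinearMap.mulLeft K ((∑ j : Fin n, (X j : MvPolynomial (Fin n) K) ^ 2) ^ (k - e))) :=
    fun x y hxy => mul_right_injective₀ (pow_ne_zero _ (sumSq_ne_zero hn)) hxy
  rw [shiftedPartialsRank_zero_eq, span_derivSet_sumSq_pow k e he,
    ← (Submodule.equivMapOfInjective _ hinj _).finrank_eq, finrank_restrictSupport_degree]

end SumSq

/-! ### The discharge -/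

/-- **Discharge of `GesmundoLandsberg2017_thm4`** (Gesmundo–Landsberg 2019, Thm. 4, after Reznick
1992): for `n ≥ 1` and `e ≤ k` the `e`-th flattening of `(x₁² + ⋯ + xₙ²)ᵏ` has rank
`binom(n + e - 1, e)` over `ℂ`. [cite: GesmundoLandsberg2017, Thm. 4] -/
theorem GesmundoLandsberg2017_thm4_holds : GesmundoLandsberg2017_thm4 :=
  fun _n _k _e hn he => flatteningRank_sumSq_pow hn he

end Literature.Barriers.ValiantsHypothesis
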